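import Summits.AtomisticToContinuum.BoseEinsteinCondensation.Theses.BECThomsonPrinciple
import Literature.MathematicalPhysics.QuantumManyBody.PeriodicBoseGasLemma33
import Literature.MathematicalPhysics.QuantumManyBody.PeriodicBoseGasThm31
import Literature.Probability.Distributions.GaussianPiDensity
import Literature.MathematicalPhysics.QuantumManyBody.WeightedCorrector

/-!
# Crux `GaussianDominationCan` — negative-side toolkit I: the crux's `Q_S`, `Θ` and source on product states

Support file (crux disprover, `stmt-AtomisticToContinuum-9479`, route BECThomsonPrinciple) for the
negative-side results on `BECThomsonPrinciple.GaussianDominationCan` (tightness of the constant,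
load-bearing hypotheses; files `ProductStates`, `CruxForms`, `LoadBearing`, `FreeConstant` of this
directory).  The crux defines, by `let`s, the cell average `P_i`, the `foldr` projections
`Q_S = Π_{i∈S} P_i Π_{i∉S} (1 - P_i)`, `Θ = Σ_{S∋0} |S|^{-1/2} Q_S Φ = P₀ n̂₀^{-1/2} Φ` and the source
integral `I = ∫ conj(Φ) e^{ik·x₀} Θ` (`⟨Φ, Λ_k†Φ⟩ = N·I` for Bose-symmetric `Φ`).  Here these objects
get names (`cellAvg`, `modeProj`, `theta`, `phase`, `sourceIntegral` — definitionally the crux's) and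
are evaluated EXACTLY on product states `Π_i g_i(x_i)`: `Q_S Π g_i = Π (i ∈ S ? ḡ_i : g_i - ḡ_i)`
(`modeProj_prodFun`, no integrability needed), together with the one-body cell integrals of the
two-mode function `a + b e_n` used by the witnesses.  All [folklore].
-/

noncomputable section

namespace Summit.AtomisticToContinuum.BoseEinsteinCondensation.Theorems.GaussianDominationCan.Negative

open MeasureTheory Literature.MathematicalPhysics.QuantumManyBody.BoseGas
open scoped ENNReal NNReal ComplexConjugate

variable {N : ℕ} {L : ℝ}

/-- The cell average of `g` in the coordinate `i` (the crux's `P i`). -/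
def cellAvg (N : ℕ) (L : ℝ) (i : Fin N) (g : Config N → ℂ) : Config N → ℂ :=
  fun X => ((L ^ 3)⁻¹ : ℝ) • ∫ y in cell L, g (Function.update X i y)

/-- `Q_S` as the crux's `foldr`. -/
def modeProj (N : ℕ) (L : ℝ) (S : Finset (Fin N)) (g : Config N → ℂ) : Config N → ℂ :=
  (List.finRange N).foldr (fun i h => if i ∈ S then cellAvg N L i h else h - cellAvg N L i h) g


/-- `Θ = P₀ n̂₀^{-1/2} ψ = Σ_{S ∋ 0} |S|^{-1/2} Q_S ψ`. -/
def theta (m : ℕ) (L : ℝ) (ψ : Config (m + 1) → ℂ) : Config (m + 1) → ℂ := fun X =>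
  ∑ S ∈ (Finset.univ : Finset (Finset (Fin (m + 1)))).filter (fun S => (0 : Fin (m + 1)) ∈ S),
    ((Real.sqrt (S.card : ℝ))⁻¹ : ℂ) * modeProj (m + 1) L S ψ X

/-- The crux's phase `e^{ik·x₀}`, `k = 2πn/L`. -/
def phase (m : ℕ) (L : ℝ) (n : Fin 3 → ℤ) (X : Config (m + 1)) : ℂ :=
  Complex.exp (Complex.I * ↑(2 * Real.pi / L * ∑ j, (n j : ℝ) * X 0 j))

/-- The source integral `I = ∫ conj(ψ) e^{ik·x₀} Θ` (so that `⟨ψ, Λ_k† ψ⟩ = N·I`). -/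
def sourceIntegral (m : ℕ) (L : ℝ) (n : Fin 3 → ℤ) (ψ : Config (m + 1) → ℂ) : ℂ :=
  ∫ X in cellN (m + 1) L, conj (ψ X) * phase m L n X * theta m L ψ X

/-- Product functions `X ↦ Π_i g_i(x_i)`. -/
def prodFun (g : Fin N → Space → ℂ) : Config N → ℂ := fun X => ∏ i, g i (X i)

/-- The cell mean `L⁻³ ∫_cell h` of a one-body function. -/
def avg (L : ℝ) (h : Space → ℂ) : ℂ := ((L ^ 3)⁻¹ : ℝ) • ∫ y in cell L, h y

/-- The factor-wise action of `Q_S` on a product function. -/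
def factorT (L : ℝ) (S : Finset (Fin N)) (i : Fin N) (h : Space → ℂ) : Space → ℂ :=
  if i ∈ S then (fun _ => avg L h) else fun x => h x - avg L h

/-- Splitting off the updated coordinate: `Π_j g_j((update X i y)_j) = g_i(y) Π_{j≠i} g_j(x_j)`. [folklore] -/
theorem prod_update_eq (g : Fin N → Space → ℂ) (X : Config N) (i : Fin N) (y : Space) :
    (∏ j, g j (Function.update X i y j)) = g i y * ∏ j ∈ Finset.univ.erase i, g j (X j) := by
  rw [← Finset.mul_prod_erase Finset.univ _ (Finset.mem_univ i), Function.update_self]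
  congr 1
  refine Finset.prod_congr rfl fun j hj => ?_
  rw [Function.update_of_ne (Finset.ne_of_mem_erase hj)]

/-- A product with one factor replaced, evaluated: `Π_j (update g i h)_j(x_j) = h(x_i) Π_{j≠i} g_j(x_j)`. [folklore] -/
theorem prodFun_update_fun (g : Fin N → Space → ℂ) (i : Fin N) (h : Space → ℂ) (X : Config N) :
    prodFun (Function.update g i h) X = h (X i) * ∏ j ∈ Finset.univ.erase i, g j (X j) := by
  unfold prodFun
  rw [← Finset.mul_prod_erase Finset.univ _ (Finset.mem_univ i), Function.update_self]
  congr 1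
  refine Finset.prod_congr rfl fun j hj => ?_
  rw [Function.update_of_ne (Finset.ne_of_mem_erase hj)]

/-- `Π_j g_j(x_j) = g_i(x_i) Π_{j≠i} g_j(x_j)`. [folklore] -/
theorem prodFun_eq_mul_erase (g : Fin N → Space → ℂ) (i : Fin N) (X : Config N) :
    prodFun g X = g i (X i) * ∏ j ∈ Finset.univ.erase i, g j (X j) :=
  (Finset.mul_prod_erase _ _ (Finset.mem_univ i)).symm

/-- **`P_i` on a product state** replaces the `i`-th factor by its cell mean (no integrability needed). [folklore] -/
theorem cellAvg_prodFun (g : Fin N → Space → ℂ) (i : Fin N) :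
    cellAvg N L i (prodFun g) = prodFun (Function.update g i fun _ => avg L (g i)) := by
  funext X
  show ((L ^ 3)⁻¹ : ℝ) • ∫ y in cell L, prodFun g (Function.update X i y) = _
  have h1 : ∀ y, prodFun g (Function.update X i y) =
      g i y * ∏ j ∈ Finset.univ.erase i, g j (X j) := fun y => prod_update_eq g X i y
  simp_rw [h1]
  rw [integral_mul_const, ← smul_mul_assoc, prodFun_update_fun]
  rfl

/-- **`1 - P_i` on a product state** replaces the `i`-th factor by its fluctuation `g_i - ḡ_i`. [folklore] -/
theorem sub_cellAvg_prodFun (g : Fin N → Space → ℂ) (i : Fin N) :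
    prodFun g - cellAvg N L i (prodFun g) =
      prodFun (Function.update g i fun x => g i x - avg L (g i)) := by
  funext X
  rw [Pi.sub_apply, cellAvg_prodFun, prodFun_update_fun, prodFun_update_fun,
    prodFun_eq_mul_erase g i X]
  ring

/-- The crux's `foldr` over a duplicate-free list acts factor-wise on product states. [folklore] -/
theorem foldr_prodFun (S : Finset (Fin N)) (g : Fin N → Space → ℂ) (l : List (Fin N))
    (hl : l.Nodup) :
    l.foldr (fun i h => if i ∈ S then cellAvg N L i h else h - cellAvg N L i h) (prodFun g) =
      prodFun (fun i => if i ∈ l then factorT L S i (g i) else g i) := by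
  induction l with
  | nil => simp
  | cons a l ih =>
    rw [List.nodup_cons] at hl
    rw [List.foldr_cons, ih hl.2]
    set g' : Fin N → Space → ℂ := fun i => if i ∈ l then factorT L S i (g i) else g i with hg'
    have hga : g' a = g a := by simp [hg', hl.1]
    have hupd : ∀ h : Space → ℂ, factorT L S a (g a) = h →
        Function.update g' a h = fun i => if i ∈ a :: l then factorT L S i (g i) else g i := by
      intro h hh
      funext i
      by_cases hia : i = a
      · subst hia
        simp [hh]
      · rw [Function.update_of_ne hia]
        simp [hg', hia]
    split_ifs with haS
    · rw [cellAvg_prodFun, hga]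
      congr 1
      exact hupd _ (by simp [factorT, haS])
    · rw [sub_cellAvg_prodFun, hga]
      congr 1
      exact hupd _ (by simp [factorT, haS])

/-- **`Q_S` on a product state**: `Q_S Π_i g_i = Π_i (i ∈ S ? ḡ_i : g_i - ḡ_i)`. [folklore] -/
theorem modeProj_prodFun (S : Finset (Fin N)) (g : Fin N → Space → ℂ) :
    modeProj N L S (prodFun g) = prodFun (fun i => factorT L S i (g i)) := by
  unfold modeProj
  rw [foldr_prodFun S g _ (List.nodup_finRange N)]
  congr 1
  funext i
  simp [List.mem_finRange]

/-! ### Product integrals over `cell^N` -/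

/-- Fubini for products on `cell^N` (Bochner): `∫_{cell^N} Π_i f_i(x_i) = Π_i ∫_cell f_i`. [folklore] -/
theorem integral_cellN_prod (f : Fin N → Space → ℂ) :
    ∫ X in cellN N L, ∏ i, f i (X i) = ∏ i, ∫ x in cell L, f i x := by
  rw [volume_restrict_cellN]
  exact integral_fintype_prod_eq_prod (𝕜 := ℂ) f

/-- Tonelli for products on `cell^N`: `∫⁻_{cell^N} Π_i f_i(x_i) = Π_i ∫⁻_cell f_i`. [folklore] -/
theorem lintegral_cellN_prod (f : Fin N → Space → ℝ≥0∞) (hf : ∀ i, Measurable (f i)) :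
    ∫⁻ X in cellN N L, ∏ i, f i (X i) = ∏ i, ∫⁻ x in cell L, f i x := by
  rw [volume_restrict_cellN]
  exact Literature.Probability.Distributions.lintegral_fin_nat_prod_eq_prod _ f hf


/-! ### One-body integrals on the cell -/

section OneBody

variable {n : Fin 3 → ℤ}

/-- `∫_cell c = L³ c` (complex constant). [folklore] -/
theorem integral_cell_const (hL : 0 < L) (c : ℂ) : ∫ _x in cell L, c = (L : ℂ) ^ 3 * c := by
  rw [setIntegral_const, Measure.real, volume_cell, ← ENNReal.ofReal_pow hL.le,
    ENNReal.toReal_ofReal (by positivity), Complex.real_smul]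
  push_cast
  ring

/-- `|cell L| = L³` as a real number. [folklore] -/
theorem volume_real_cell (hL : 0 ≤ L) : (volume : Measure Space).real (cell L) = L ^ 3 := by
  rw [Measure.real, volume_cell, ← ENNReal.ofReal_pow hL, ENNReal.toReal_ofReal (by positivity)]

/-- The cell mean of a constant is the constant. [folklore] -/
theorem avg_const (hL : 0 < L) (c : ℂ) : avg L (fun _ => c) = c := by
  unfold avg
  rw [integral_cell_const hL, Complex.real_smul]
  have : (L : ℂ) ≠ 0 := by exact_mod_cast hL.ne'
  push_cast
  field_simp

/-- `∫_cell conj(e_n) = 0` for `n ≠ 0`. [folklore] -/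
theorem integral_cell_conj_cellWave (hL : 0 < L) (hn : n ≠ 0) :
    ∫ x in cell L, conj (cellWave L n x) = 0 := by
  simp_rw [conj_cellWave]
  exact integral_cell_cellWave_eq_zero hL (neg_ne_zero.mpr hn)

/-- `conj(e_n) e_n = 1`. [folklore] -/
theorem conj_cellWave_mul_self (L : ℝ) (n : Fin 3 → ℤ) (x : Space) :
    conj (cellWave L n x) * cellWave L n x = 1 := by
  rw [conj_cellWave, ← cellWave_add_index, neg_add_cancel, cellWave_zero]

attribute [fun_prop] Literature.MathematicalPhysics.QuantumManyBody.BoseGas.continuous_cellWave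

/-- The one-body function `a + b e_n` (two plane waves). -/
def oneBody (L : ℝ) (n : Fin 3 → ℤ) (a b : ℝ) (x : Space) : ℂ :=
  (a : ℂ) + (b : ℂ) * cellWave L n x

/-- `a + b e_n` is continuous. [folklore] -/
theorem continuous_oneBody (L : ℝ) (n : Fin 3 → ℤ) (a b : ℝ) : Continuous (oneBody L n a b) :=
  continuous_const.add (continuous_const.mul (contDiff_cellWave L n).continuous)

/-- `a + b e_n` is `C¹`. [folklore] -/
theorem contDiff_oneBody (L : ℝ) (n : Fin 3 → ℤ) (a b : ℝ) : ContDiff ℝ 1 (oneBody L n a b) :=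
  contDiff_const.add (contDiff_const.mul ((contDiff_cellWave L n).of_le (mod_cast le_top)))

/-- `a + b e_n` is differentiable. [folklore] -/
theorem differentiable_oneBody (L : ℝ) (n : Fin 3 → ℤ) (a b : ℝ) :
    Differentiable ℝ (oneBody L n a b) :=
  (contDiff_oneBody L n a b).differentiable one_ne_zero

/-- `a + b e_n` is `Lℤ³`-periodic. [folklore] -/
theorem oneBody_periodic (hL : L ≠ 0) (a b : ℝ) (x : Space) (k : Fin 3) :
    oneBody L n a b (x + EuclideanSpace.single k L) = oneBody L n a b x := by
  simp [oneBody, cellWave_periodic hL]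

/-- `∫_cell (a + b e_n) = L³ a` for `n ≠ 0`. [folklore] -/
theorem integral_cell_oneBody (hL : 0 < L) (hn : n ≠ 0) (a b : ℝ) :
    ∫ x in cell L, oneBody L n a b x = (L : ℂ) ^ 3 * a := by
  unfold oneBody
  rw [integral_add (integrableOn_cell (f := fun _ => (a : ℂ)) continuous_const)
      (integrableOn_cell (f := fun x => (b : ℂ) * cellWave L n x) (by fun_prop)),
    integral_cell_const hL, integral_const_mul, integral_cell_cellWave_eq_zero hL hn, mul_zero,
    add_zero]

/-- The cell mean of `a + b e_n` is `a` (`n ≠ 0`). [folklore] -/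
theorem avg_oneBody (hL : 0 < L) (hn : n ≠ 0) (a b : ℝ) : avg L (oneBody L n a b) = a := by
  unfold avg
  rw [integral_cell_oneBody hL hn, Complex.real_smul]
  have : (L : ℂ) ≠ 0 := by exact_mod_cast hL.ne'
  push_cast
  field_simp

/-- `∫ conj(a + b e) · e · c = L³ b c`. -/
theorem integral_conj_oneBody_wave_mul (hL : 0 < L) (hn : n ≠ 0) (a b : ℝ) (c : ℂ) :
    ∫ x in cell L, conj (oneBody L n a b x) * cellWave L n x * c = (L : ℂ) ^ 3 * b * c := by
  have h : ∀ x, conj (oneBody L n a b x) * cellWave L n x * c =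
      (a * c : ℂ) * cellWave L n x + (b * c : ℂ) := by
    intro x
    unfold oneBody
    rw [map_add, map_mul, Complex.conj_ofReal, Complex.conj_ofReal]
    have := conj_cellWave_mul_self L n x
    linear_combination (b * c : ℂ) * this
  simp_rw [h]
  rw [integral_add (integrableOn_cell (f := fun x => (a * c : ℂ) * cellWave L n x) (by fun_prop))
      (integrableOn_cell (f := fun _ => (b * c : ℂ)) continuous_const),
    integral_const_mul, integral_cell_cellWave_eq_zero hL hn, mul_zero, zero_add,
    integral_cell_const hL]
  ring

/-- `∫ conj(a + b e) · c = L³ a c`. -/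
theorem integral_conj_oneBody_mul (hL : 0 < L) (hn : n ≠ 0) (a b : ℝ) (c : ℂ) :
    ∫ x in cell L, conj (oneBody L n a b x) * c = (L : ℂ) ^ 3 * a * c := by
  have h : ∀ x, conj (oneBody L n a b x) * c =
      (a * c : ℂ) + (b * c : ℂ) * conj (cellWave L n x) := by
    intro x
    unfold oneBody
    rw [map_add, map_mul, Complex.conj_ofReal, Complex.conj_ofReal]
    ring
  simp_rw [h]
  rw [integral_add (integrableOn_cell (f := fun _ => (a * c : ℂ)) continuous_const)
      (integrableOn_cell (f := fun x => (b * c : ℂ) * conj (cellWave L n x)) (by fun_prop)),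
    integral_cell_const hL, integral_const_mul, integral_cell_conj_cellWave hL hn, mul_zero,
    add_zero]
  ring

/-- `∫ conj(a + b e) · (c e) = L³ b c`. -/
theorem integral_conj_oneBody_mul_wave (hL : 0 < L) (hn : n ≠ 0) (a b : ℝ) (c : ℂ) :
    ∫ x in cell L, conj (oneBody L n a b x) * (c * cellWave L n x) = (L : ℂ) ^ 3 * b * c := by
  have h : ∀ x, conj (oneBody L n a b x) * (c * cellWave L n x) =
      conj (oneBody L n a b x) * cellWave L n x * c := fun x => by ring
  simp_rw [h]
  exact integral_conj_oneBody_wave_mul hL hn a b c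

/-- `(Re e_n)² + (Im e_n)² = 1`. [folklore] -/
theorem normSq_cellWave (L : ℝ) (n : Fin 3 → ℤ) (x : Space) :
    (cellWave L n x).re ^ 2 + (cellWave L n x).im ^ 2 = 1 := by
  have h := norm_cellWave L n x
  rw [← Complex.normSq_add_mul_I, Complex.re_add_im, Complex.normSq_eq_norm_sq, h, one_pow]

/-- `|a + b e_n|² = a² + b² + 2ab Re e_n` for real `a, b`. [folklore] -/
theorem norm_sq_oneBody (a b : ℝ) (x : Space) :
    ‖oneBody L n a b x‖ ^ 2 = a ^ 2 + b ^ 2 + 2 * a * b * (cellWave L n x).re := by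
  have h := normSq_cellWave L n x
  rw [Complex.sq_norm, Complex.normSq_apply]
  simp only [oneBody, Complex.add_re, Complex.ofReal_re, Complex.mul_re, Complex.ofReal_im,
    zero_mul, sub_zero, Complex.add_im, Complex.mul_im, add_zero, zero_add]
  linear_combination b ^ 2 * h

/-- `∫_cell Re e_n = 0` for `n ≠ 0`. [folklore] -/
theorem integral_cell_re_cellWave (hL : 0 < L) (hn : n ≠ 0) :
    ∫ x in cell L, (cellWave L n x).re = 0 := by
  have h := integral_re (integrableOn_cell (L := L) (contDiff_cellWave L n).continuous)
  simp only [RCLike.re_to_complex] at h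
  rw [h, integral_cell_cellWave_eq_zero hL hn, Complex.zero_re]

/-- `∫_cell |a + b e_n|² = (a² + b²) L³` for `n ≠ 0`. [folklore] -/
theorem integral_norm_sq_oneBody (hL : 0 < L) (hn : n ≠ 0) (a b : ℝ) :
    ∫ x in cell L, ‖oneBody L n a b x‖ ^ 2 = (a ^ 2 + b ^ 2) * L ^ 3 := by
  simp_rw [norm_sq_oneBody]
  rw [integral_add (integrableOn_cell (f := fun _ => a ^ 2 + b ^ 2) continuous_const)
      (integrableOn_cell (f := fun x => 2 * a * b * (cellWave L n x).re) (by fun_prop))]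
  rw [setIntegral_const, volume_real_cell hL.le, integral_const_mul, integral_cell_re_cellWave hL hn,
    mul_zero, add_zero, smul_eq_mul, mul_comm]

/-- `∫⁻_cell ‖a + b e_n‖₊² = (a² + b²) L³` (`ℝ≥0∞` form). [folklore] -/
theorem lintegral_nnnorm_sq_oneBody (hL : 0 < L) (hn : n ≠ 0) (a b : ℝ) :
    ∫⁻ x in cell L, (‖oneBody L n a b x‖₊ : ℝ≥0∞) ^ 2 = ENNReal.ofReal ((a ^ 2 + b ^ 2) * L ^ 3) := by
  simp_rw [coe_nnnorm_sq_eq_ofReal]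
  rw [← ofReal_integral_eq_lintegral_ofReal (integrableOn_sq_cell L (continuous_oneBody L n a b))
    (Filter.Eventually.of_forall fun x => by positivity), integral_norm_sq_oneBody hL hn]

/-- `∫⁻_cell c = c L³`. [folklore] -/
theorem lintegral_cell_const (L : ℝ) (c : ℝ≥0∞) :
    ∫⁻ _x in cell L, c = c * ENNReal.ofReal L ^ 3 := by
  rw [setLIntegral_const, volume_cell]

/-- `∂_j (a + b e_n) = b (2πi n_j/L) e_n`. [folklore] -/
theorem fderiv_oneBody_single (a b : ℝ) (x : Space) (j : Fin 3) :
    fderiv ℝ (oneBody L n a b) x (EuclideanSpace.single j 1) =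
      (b : ℂ) * ((2 * Real.pi * Complex.I * (n j) / L) * cellWave L n x) := by
  unfold oneBody
  rw [fderiv_const_add, fderiv_const_mul (((contDiff_cellWave L n).differentiable (by simp)) x),
    FunLike.coe_smul, Pi.smul_apply, fderiv_cellWave_apply_single, smul_eq_mul]

/-- `|2πi n_j/L| = 2π|n_j|/L`. [folklore] -/
theorem norm_waveCoeff (hL : 0 < L) (j : Fin 3) :
    ‖(2 * Real.pi * Complex.I * (n j) / L : ℂ)‖ = 2 * Real.pi * |(n j : ℝ)| / L := by
  rw [show (2 * Real.pi * Complex.I * (n j) / L : ℂ) = ((2 * Real.pi * (n j : ℝ) / L : ℝ) : ℂ) *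
      Complex.I by push_cast; ring]
  rw [norm_mul, Complex.norm_I, mul_one, Complex.norm_real, Real.norm_eq_abs, abs_div, abs_mul,
    abs_of_pos (by positivity : (0 : ℝ) < 2 * Real.pi), abs_of_pos hL]

/-- `‖∂_j (a + b e_n)‖₊² = b² 4π² n_j²/L²`. [folklore] -/
theorem nnnorm_sq_fderiv_oneBody (hL : 0 < L) (a b : ℝ) (x : Space) (j : Fin 3) :
    ((‖fderiv ℝ (oneBody L n a b) x (EuclideanSpace.single j 1)‖₊ : ℝ≥0∞) ^ 2) =
      ENNReal.ofReal (b ^ 2 * (4 * Real.pi ^ 2 * (n j : ℝ) ^ 2 / L ^ 2)) := by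
  rw [fderiv_oneBody_single, coe_nnnorm_sq_eq_ofReal, norm_mul, norm_mul, norm_waveCoeff hL,
    norm_cellWave, mul_one, Complex.norm_real, Real.norm_eq_abs, mul_pow, sq_abs]
  congr 1
  rw [div_pow, mul_pow, sq_abs]
  ring

/-- `|n|² = Σ_j n_j²` (Euclidean). -/
def nsq (n : Fin 3 → ℤ) : ℝ := ∑ j, (n j : ℝ) ^ 2

/-- `|n|² ≥ 0`. [folklore] -/
theorem nsq_nonneg (n : Fin 3 → ℤ) : 0 ≤ nsq n := Finset.sum_nonneg fun j _ => by positivity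

/-- `|∇(a + b e_n)|² = b² 4π²|n|²/L²` (constant in `x`). [folklore] -/
theorem sum_nnnorm_sq_fderiv_oneBody (hL : 0 < L) (a b : ℝ) (x : Space) :
    ∑ j : Fin 3, ((‖fderiv ℝ (oneBody L n a b) x (EuclideanSpace.single j 1)‖₊ : ℝ≥0∞) ^ 2) =
      ENNReal.ofReal (b ^ 2 * (4 * Real.pi ^ 2 * nsq n / L ^ 2)) := by
  simp_rw [nnnorm_sq_fderiv_oneBody hL]
  rw [← ENNReal.ofReal_sum_of_nonneg (fun j _ => by positivity)]
  congr 1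
  unfold nsq
  rw [Finset.mul_sum, Finset.sum_div, Finset.mul_sum]

end OneBody

end Summit.AtomisticToContinuum.BoseEinsteinCondensation.Theorems.GaussianDominationCan.Negative

end
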